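import Literature.MathematicalPhysics.QuantumLattice.EmeryThreeBandRingWindowFloor
import HarnessLib

/-!
# Every window containing the `Cu₃O₄` ring gives a turnkey Emery cluster floor (larger Cu–O clusters, no new side condition)

Topic `Literature/MathematicalPhysics/QuantumLattice` (family `hubbard`; crew hubbard-fast S2 (iv) «three-band Emery boxes»).
`EmeryThreeBandRingWindowFloor` discharged the fit hypothesis of the Emery cluster floor for the 7-site ring `emeryRingWindow`. The fit
hypothesis is MONOTONE in the window: a superlattice translate inside `W` is inside every `B ⊇ W`. Hence every finite window containing the ring —
the 8-site `[0,3)² ∖ {(1,1)}` (adds the Cu at `(2,2)`, Fock dimension `4⁸`), `Cu₄O₈`-type `2 × 2`-cell windows, strips — yields the floor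
`q₀/(4M) ≤ emeryEnergyDensity θ ρ` from ONE certificate with the uniform `(2ℤ)²`-weights of THAT window, with no side condition but the certificate
(`le_emeryEnergyDensity_of_windowCertificate`). Everything is PROVED; no definition, no named fact, no number.

## Mathlib / tree search

REUSED: `emeryRingWindow_fit`, `le_emeryEnergyDensity_of_posSemidef_uniform` (`EmeryThreeBandRingWindowFloor`, `WeightedOpenClusterUniformWeightsPeriodic`).
`lean search 'fit_of_subset|windowCertificate'` (2026-08-28): nothing.

## References

* R. Valentí, J. Stolze, P. J. Hirschfeld, Phys. Rev. B 43 (1991) 13743, §II (larger clusters, same cover identity). [cite: ValentiStolzeHirschfeld1991, §II]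
* P. W. Anderson, Phys. Rev. 83 (1951) 1260, eq. (2). [cite: Anderson1951, eq. (2)]
-/

noncomputable section

open scoped ComplexOrder BigOperators
open Finset

namespace Literature.MathematicalPhysics.QuantumLattice

open Matrix HubbardWave0 Literature.Probability.LatticeModels ThermodynamicLimit
open scoped Matrix.Norms.L2Operator

/-- **The fit hypothesis is monotone in the window** (any periodic interaction, any periods): shapes that fit in `W` fit in every `B ⊇ W`.
[cite: ValentiStolzeHirschfeld1991, §II] -/
theorem periodicFit_mono {d : ℕ} {q : Fin d → ℕ} {Ψ : FermionInteraction d} {W B : Finset (Site d)} (hWB : W ⊆ B)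
    (hfit : ∀ (c : Cell q) (X : Finset (Site d)), cellPos c ∈ X → Ψ.Φ X ≠ 0 → ∃ v : Site d, InCoset q 0 v ∧ shiftSet v X ⊆ W) :
    ∀ (c : Cell q) (X : Finset (Site d)), cellPos c ∈ X → Ψ.Φ X ≠ 0 → ∃ v : Site d, InCoset q 0 v ∧ shiftSet v X ⊆ B :=
  fun c X hc hX => by
    obtain ⟨v, hv, hvW⟩ := hfit c X hc hX
    exact ⟨v, hv, hvW.trans hWB⟩

/-- **Every window containing the ring fits the three-band interaction.** [cite: ValentiStolzeHirschfeld1991, §II] -/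
theorem emeryWindow_fit_of_ring_subset (θ : Fin 14 → ℝ) {B : Finset (Site 2)} (hB : emeryRingWindow ⊆ B) :
    ∀ (c : Cell liebPeriods) (X : Finset (Site 2)), cellPos c ∈ X → (emeryInteraction θ).Φ X ≠ 0 →
      ∃ v : Site 2, InCoset liebPeriods 0 v ∧ shiftSet v X ⊆ B :=
  periodicFit_mono hB (emeryRingWindow_fit θ)

namespace InfVolFermionState

/-- **TURNKEY EMERY FLOOR ON ANY WINDOW CONTAINING THE RING.** For a finite `B ⊇ emeryRingWindow`, `M > 0`, any `G ∈ 𝔄_B` killed by every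
`2×2`-periodic state, and a certificate `H^{w}_B[emeryInteraction θ] + G − q₀·1 ⪰ 0` with the uniform `(2ℤ)²`-weight of `B` of mass `M`:
`q₀/(4M) ≤ emeryEnergyDensity θ ρ` (nonempty class). [cite: Anderson1951, eq. (2)] [cite: ValentiStolzeHirschfeld1991, §II] -/
theorem le_emeryEnergyDensity_of_windowCertificate (θ : Fin 14 → ℝ) {ρ : ℝ} (hS : (emeryStates ρ).Nonempty) {B : Finset (Site 2)}
    (hB : emeryRingWindow ⊆ B) {M : ℝ} (hM : 0 < M)
    {G : FermionOp B} (hG0 : ∀ ω' : InfVolFermionState 2, ω'.IsPeriodic liebPeriods → (ω'.expect B G).re = 0) {q₀ : ℝ}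
    (hq : ((⟨fun X => (uniformPeriodicWeight liebPeriods B M X : ℂ) • (emeryInteraction θ).Φ X⟩ : FermionInteraction 2).localHamiltonian B + G -
      (q₀ : ℂ) • (1 : FermionOp B)).PosSemidef) :
    q₀ / (4 * M) ≤ emeryEnergyDensity θ ρ :=
  le_emeryEnergyDensity_of_posSemidef_uniform θ hS B hM (emeryWindow_fit_of_ring_subset θ hB) hG0 hq

end InfVolFermionState

end Literature.MathematicalPhysics.QuantumLattice

end
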